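import Summits.QuantumFields.YangMills.Theorems.SwapVirialDeficitSwapRingLeaderEvent
import Summits.QuantumFields.YangMills.Theorems.SwapTwistDeficitPeriodicRingFloorSharp
import HarnessLib

/-!
# The LOG-FREE floor of the σ-glued zero-flux trace at fixed `L` from a leader volume bound:
# `c·s⁷ ≤ Haar⁴{σ-twisted nearly commuting}` ⟹ `c_L·u^{9L⁴−1} ≤ μ_L{F^S_0 ≤ u}` and `c_L·e^{12βL⁴}·β^{−(9L⁴−1)} ≤ TT.twistTrace L β (2L)`
# (brick (α2-v) of LEAD ym-line-sfw-p2 g93's fixed-`L` programme; free-hands support of item stmt-QuantumFields-24197 `SwapVirialDeficit.SwapGluedStiffness`;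
# the leader volume `≍ s⁷` = three nearly commuting letters `s⁴` (seat w2 g54's (α1)) × the slaved letter `C₁ ≈ c⁻¹C₀c`, `s³`, is consumed as a HYPOTHESIS
# of the stated shape so that the two halves land independently, as in ✓`PeriodicRingFloor.log_volume_floor_of_fourLetterVolume`)

* §1 `measurableSet_swapCommSet`;
* §2 ★★ `swap_volume_floor_of_leaderVolume` — `c·(1/34)^{6L⁴−3}·(u/(1200L⁴))^{9L⁴−1} ≤ (ringMeasure L).real {F^S_0 ≤ u}` for `0 < u ≤ 1200L⁴s₀²`;
* §3 ★★ `swap_laplace_floor_of_leaderVolume`, ★★ `swap_twistTrace_floor_of_leaderVolume` — for `β ≥ max 1 (1200L⁴s₀²)⁻¹`: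
  `(1/8)·e^{12βL⁴}·e^{−1}c(1/34)^{6L⁴−3}(1200L⁴β)^{−(9L⁴−1)} ≤ TT.twistTrace L β (2L)` — exponent `9L⁴ − 1` (generic σ-flat stratum `C₀ = C₁` of dimension `3`,
  one below the periodic `4`), no logarithm (the swap-central zero-mode block is a cone of commuting TRIPLES, pole `2`, multiplicity `1`), against the
  periodic `9L⁴ − 3/2` + log of ✓`log_physTrace_floor` — the fixed-`L` stratum census of seat w2 g54's memo SWAP-STRATA, one-sided.

HONEST FRAMING: the cheap direction (a floor) of a fixed-`L` Laplace asymptotic for the σ-glued ring, with `exp(−O(L⁴ log L))`-class constants and conditional on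
a leader volume bound of the stated shape; the CEILING (the stiffness direction ⟨24197⟩/⟨24194⟩ consume) is NOT proved; no crux, rung or summit is proved; the
Yang–Mills mass gap is NOT proved; no summit is proved by a line.  THEOREMS ONLY (0 `def`, 0 `sorry`), standard axioms.  Width seat ym-line-sfw-p2-w3 g61
(cell ym-idea-1, free hands), `--supports stmt-QuantumFields-24197`.  References: [cite: tHooft1979]; [cite: Luscher1983, §2]; [cite: GonzalezarroyoAltes1988]; [cite: Vanbaal2001].
-/

set_option autoImplicit false

noncomputable section

open MeasureTheory
open scoped BigOperators ENNReal
open Literature.MathematicalPhysics.QuantumFieldTheory hiding SU2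
open Literature.MathematicalPhysics.QuantumLattice

namespace Summit.QuantumFields.YangMills.Theorems.SwapVirialDeficit.SwapRing

open Summit.QuantumFields.YangMills.Theorems.FemtoTransferGap
open Summit.QuantumFields.YangMills.Theorems.FemtoTransferGap.TT
open Summit.QuantumFields.YangMills.Theorems.VirialFluxGap.RingDeficit
open Summit.QuantumFields.YangMills.Theorems.SwapTwistDeficit.PeriodicRingFloor

variable {L : ℕ} [NeZero L]

/-! ## §1 The σ-twisted nearly-commuting leader event is measurable -/

/-- The σ-twisted nearly-commuting set of quadruples (Frobenius form) is measurable (closed). [folklore] -/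
theorem measurableSet_swapCommSet (s : ℝ) :
    MeasurableSet {C : Fin 4 → SU2 |
      (∀ μ ν : Fin 3, frobNorm (((C (Fin.castSucc μ) * C (Fin.castSucc ν) : SU2) : Matrix (Fin 2) (Fin 2) ℂ) -
        ((C (Fin.castSucc ν) * C (Fin.castSucc μ) : SU2) : Matrix (Fin 2) (Fin 2) ℂ)) ≤ s) ∧
      ∀ μ : Fin 3, frobNorm (((C (Fin.last 3) * C (Fin.castSucc (Equiv.swap (0 : Fin 3) 1 μ)) : SU2) : Matrix (Fin 2) (Fin 2) ℂ) -
        ((C (Fin.castSucc μ) * C (Fin.last 3) : SU2) : Matrix (Fin 2) (Fin 2) ℂ)) ≤ s} := by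
  have hc : ∀ k l : Fin 4, Continuous fun C : Fin 4 → SU2 =>
      frobNorm (((C k * C l : SU2) : Matrix (Fin 2) (Fin 2) ℂ) - ((C l * C k : SU2) : Matrix (Fin 2) (Fin 2) ℂ)) := by
    intro k l
    refine continuous_frobNorm'.comp ?_
    exact (continuous_subtype_val.comp ((continuous_apply k).mul (continuous_apply l))).sub
      (continuous_subtype_val.comp ((continuous_apply l).mul (continuous_apply k)))
  have h1 : MeasurableSet {C : Fin 4 → SU2 | ∀ μ ν : Fin 3,
      frobNorm (((C (Fin.castSucc μ) * C (Fin.castSucc ν) : SU2) : Matrix (Fin 2) (Fin 2) ℂ) -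
        ((C (Fin.castSucc ν) * C (Fin.castSucc μ) : SU2) : Matrix (Fin 2) (Fin 2) ℂ)) ≤ s} := by
    have e : {C : Fin 4 → SU2 | ∀ μ ν : Fin 3,
        frobNorm (((C (Fin.castSucc μ) * C (Fin.castSucc ν) : SU2) : Matrix (Fin 2) (Fin 2) ℂ) -
          ((C (Fin.castSucc ν) * C (Fin.castSucc μ) : SU2) : Matrix (Fin 2) (Fin 2) ℂ)) ≤ s} =
        ⋂ μ : Fin 3, ⋂ ν : Fin 3, {C : Fin 4 → SU2 |
          frobNorm (((C (Fin.castSucc μ) * C (Fin.castSucc ν) : SU2) : Matrix (Fin 2) (Fin 2) ℂ) -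
            ((C (Fin.castSucc ν) * C (Fin.castSucc μ) : SU2) : Matrix (Fin 2) (Fin 2) ℂ)) ≤ s} := by
      ext C; simp only [Set.mem_setOf_eq, Set.mem_iInter]
    rw [e]
    exact MeasurableSet.iInter fun μ => MeasurableSet.iInter fun ν => (isClosed_le (hc _ _) continuous_const).measurableSet
  have h2 : MeasurableSet {C : Fin 4 → SU2 | ∀ μ : Fin 3,
      frobNorm (((C (Fin.last 3) * C (Fin.castSucc (Equiv.swap (0 : Fin 3) 1 μ)) : SU2) : Matrix (Fin 2) (Fin 2) ℂ) -
        ((C (Fin.castSucc μ) * C (Fin.last 3) : SU2) : Matrix (Fin 2) (Fin 2) ℂ)) ≤ s} := by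
    have e : {C : Fin 4 → SU2 | ∀ μ : Fin 3,
        frobNorm (((C (Fin.last 3) * C (Fin.castSucc (Equiv.swap (0 : Fin 3) 1 μ)) : SU2) : Matrix (Fin 2) (Fin 2) ℂ) -
          ((C (Fin.castSucc μ) * C (Fin.last 3) : SU2) : Matrix (Fin 2) (Fin 2) ℂ)) ≤ s} =
        ⋂ μ : Fin 3, {C : Fin 4 → SU2 |
          frobNorm (((C (Fin.last 3) * C (Fin.castSucc (Equiv.swap (0 : Fin 3) 1 μ)) : SU2) : Matrix (Fin 2) (Fin 2) ℂ) -
            ((C (Fin.castSucc μ) * C (Fin.last 3) : SU2) : Matrix (Fin 2) (Fin 2) ℂ)) ≤ s} := by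
      ext C; simp only [Set.mem_setOf_eq, Set.mem_iInter]
    rw [e]
    refine MeasurableSet.iInter fun μ => (isClosed_le ?_ continuous_const).measurableSet
    refine continuous_frobNorm'.comp ?_
    exact (continuous_subtype_val.comp ((continuous_apply (Fin.last 3)).mul
        (continuous_apply (Fin.castSucc (Equiv.swap (0 : Fin 3) 1 μ))))).sub
      (continuous_subtype_val.comp ((continuous_apply (Fin.castSucc μ)).mul (continuous_apply (Fin.last 3))))
  exact h1.inter h2 |>.congr (by ext C; simp only [Set.mem_inter_iff, Set.mem_setOf_eq])

/-! ## §2 The log-free volume floor of the σ-glued deficit from a leader-event volume bound -/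

/-- ★★ **LOG-FREE VOLUME FLOOR OF THE σ-GLUED DEFICIT FROM A LEADER VOLUME BOUND.**  If the Haar⁴-volume of the σ-twisted nearly-commuting quadruples of
radius `s` is at least `c·s⁷` for `0 < s ≤ s₀` (three nearly commuting letters `≍ s⁴` — the swap-central cone of commuting triples, no logarithm — times the
slaved letter `C₁ ≈ c⁻¹C₀c`, `≍ s³`), then for `0 < u ≤ 1200·L⁴·s₀²`:
`c·(1/34)^{6L⁴−3}·(u/(1200L⁴))^{9L⁴−1} ≤ (ringMeasure L).real {F^S_0 ≤ u}` — the real log-canonical threshold `9L⁴ − 1` of the σ-glued valley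
(`18L⁴ − 2` massive directions), log-free.  Leaders at radius `s = √(u/(1200L⁴))`, fluctuations `t₂ = s` (✓`pi_real_mul_ballVol_pow_le_ringMeasure_real_swapDeficit_le`,
`300(2s)² ≤ 1200s²`), `ballVol s ≥ s³/34`, `s⁷·(s³)^{6L⁴−3} = (s²)^{9L⁴−1}`. [cite: Luscher1983, §2] [cite: tHooft1979] [cite: GonzalezarroyoAltes1988] -/
theorem swap_volume_floor_of_leaderVolume {c s₀ : ℝ} (hs₀ : 0 < s₀) (hs₀1 : s₀ ≤ 1)
    (hvol : ∀ s : ℝ, 0 < s → s ≤ s₀ → c * s ^ 7 ≤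
      (Measure.pi fun _ : Fin 4 => haarProbability SU2).real {C : Fin 4 → SU2 |
        (∀ μ ν : Fin 3, frobNorm (((C (Fin.castSucc μ) * C (Fin.castSucc ν) : SU2) : Matrix (Fin 2) (Fin 2) ℂ) -
          ((C (Fin.castSucc ν) * C (Fin.castSucc μ) : SU2) : Matrix (Fin 2) (Fin 2) ℂ)) ≤ s) ∧
        ∀ μ : Fin 3, frobNorm (((C (Fin.last 3) * C (Fin.castSucc (Equiv.swap (0 : Fin 3) 1 μ)) : SU2) : Matrix (Fin 2) (Fin 2) ℂ) -
          ((C (Fin.castSucc μ) * C (Fin.last 3) : SU2) : Matrix (Fin 2) (Fin 2) ℂ)) ≤ s})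
    {u : ℝ} (hu0 : 0 < u) (hu : u ≤ 1200 * (L : ℝ) ^ 4 * s₀ ^ 2) :
    c * (1 / 34 : ℝ) ^ (6 * L ^ 4 - 3) * (u / (1200 * (L : ℝ) ^ 4)) ^ (9 * L ^ 4 - 1) ≤
      (ringMeasure L).real {P | swapRingDeficit L (fun _ => false) P ≤ u} := by
  haveI := isProbabilityMeasure_ringMeasure (L := L)
  have hL1 : 1 ≤ L := NeZero.one_le
  have hL : (1 : ℝ) ≤ L := by exact_mod_cast hL1
  have hK : (0 : ℝ) < 1200 * (L : ℝ) ^ 4 := by positivity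
  set x : ℝ := u / (1200 * (L : ℝ) ^ 4) with hx
  have hx0 : 0 < x := div_pos hu0 hK
  set s : ℝ := Real.sqrt x with hs
  have hs0 : 0 < s := Real.sqrt_pos.2 hx0
  have hss₀ : s ≤ s₀ := by
    have hx' : x ≤ s₀ ^ 2 := by rw [hx, div_le_iff₀ hK]; linarith
    calc s = Real.sqrt x := rfl
      _ ≤ Real.sqrt (s₀ ^ 2) := Real.sqrt_le_sqrt hx'
      _ = s₀ := Real.sqrt_sq hs₀.le
  have hs1 : s ≤ 1 := hss₀.trans hs₀1
  -- the leader event and the box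
  have hE := pi_real_mul_ballVol_pow_le_ringMeasure_real_swapDeficit_le (L := L) hs0.le (s := s) hs0.le
    {C : Fin 4 → SU2 |
      (∀ μ ν : Fin 3, frobNorm (((C (Fin.castSucc μ) * C (Fin.castSucc ν) : SU2) : Matrix (Fin 2) (Fin 2) ℂ) -
        ((C (Fin.castSucc ν) * C (Fin.castSucc μ) : SU2) : Matrix (Fin 2) (Fin 2) ℂ)) ≤ s) ∧
      ∀ μ : Fin 3, frobNorm (((C (Fin.last 3) * C (Fin.castSucc (Equiv.swap (0 : Fin 3) 1 μ)) : SU2) : Matrix (Fin 2) (Fin 2) ℂ) -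
        ((C (Fin.castSucc μ) * C (Fin.last 3) : SU2) : Matrix (Fin 2) (Fin 2) ℂ)) ≤ s}
    (measurableSet_swapCommSet s) (fun C hC => hC)
  -- the deficit level `300L⁴(s+s)² = 1200L⁴s² = u`
  have hlevel : 300 * (L : ℝ) ^ 4 * (s + s) ^ 2 = u := by
    have e2 : s ^ 2 = x := by rw [hs, Real.sq_sqrt hx0.le]
    calc 300 * (L : ℝ) ^ 4 * (s + s) ^ 2 = 1200 * (L : ℝ) ^ 4 * s ^ 2 := by ring
      _ = u := by rw [e2, hx]; field_simp
  rw [hlevel] at hE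
  refine le_trans ?_ hE
  have hv := hvol s hs0 hss₀
  have hb : s ^ 3 / 34 ≤ ballVol s := pow_three_div_le_ballVol hs0.le (by linarith)
  have hbpow : (s ^ 3 / 34) ^ (6 * L ^ 4 - 3) ≤ ballVol s ^ (6 * L ^ 4 - 3) := pow_le_pow_left₀ (by positivity) hb _
  have h3 : 3 ≤ 6 * L ^ 4 := by nlinarith [Nat.one_le_pow 4 L hL1]
  have h1' : 1 ≤ 9 * L ^ 4 := by nlinarith [Nat.one_le_pow 4 L hL1]
  -- `s⁷ · (s³)^{6L⁴−3} = (s²)^{9L⁴−1} = x^{9L⁴−1}`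
  have hpow : s ^ 7 * (s ^ 3) ^ (6 * L ^ 4 - 3) = x ^ (9 * L ^ 4 - 1) := by
    have e2 : s ^ 2 = x := by rw [hs, Real.sq_sqrt hx0.le]
    rw [← e2, ← pow_mul, ← pow_mul, ← pow_add]
    congr 1
    omega
  calc c * (1 / 34 : ℝ) ^ (6 * L ^ 4 - 3) * x ^ (9 * L ^ 4 - 1)
      = (c * (s ^ 7 * (s ^ 3) ^ (6 * L ^ 4 - 3))) * (1 / 34 : ℝ) ^ (6 * L ^ 4 - 3) := by rw [hpow]; ring
    _ = (c * s ^ 7) * (s ^ 3 / 34) ^ (6 * L ^ 4 - 3) := by simp only [div_eq_mul_inv]; ring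
    _ ≤ _ := mul_le_mul hv hbpow (by positivity) measureReal_nonneg

/-! ## §3 The log-free Laplace and σ-glued trace floors -/

/-- ★★ **LOG-FREE LAPLACE FLOOR OF THE σ-GLUED DEFICIT** from a leader volume bound: for `β ≥ 1` with `(1200L⁴s₀²)⁻¹ ≤ β`,
`e^{−1}·c(1/34)^{6L⁴−3}·(1200L⁴β)^{−(9L⁴−1)} ≤ ∫ e^{−βF^S_0} dμ_L`. [cite: Luscher1983, §2] -/
theorem swap_laplace_floor_of_leaderVolume {c s₀ : ℝ} (hs₀ : 0 < s₀) (hs₀1 : s₀ ≤ 1)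
    (hvol : ∀ s : ℝ, 0 < s → s ≤ s₀ → c * s ^ 7 ≤
      (Measure.pi fun _ : Fin 4 => haarProbability SU2).real {C : Fin 4 → SU2 |
        (∀ μ ν : Fin 3, frobNorm (((C (Fin.castSucc μ) * C (Fin.castSucc ν) : SU2) : Matrix (Fin 2) (Fin 2) ℂ) -
          ((C (Fin.castSucc ν) * C (Fin.castSucc μ) : SU2) : Matrix (Fin 2) (Fin 2) ℂ)) ≤ s) ∧
        ∀ μ : Fin 3, frobNorm (((C (Fin.last 3) * C (Fin.castSucc (Equiv.swap (0 : Fin 3) 1 μ)) : SU2) : Matrix (Fin 2) (Fin 2) ℂ) -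
          ((C (Fin.castSucc μ) * C (Fin.last 3) : SU2) : Matrix (Fin 2) (Fin 2) ℂ)) ≤ s})
    {β : ℝ} (hβ : 1 ≤ β) (hβ₀ : (1200 * (L : ℝ) ^ 4 * s₀ ^ 2)⁻¹ ≤ β) :
    Real.exp (-1) * (c * (1 / 34 : ℝ) ^ (6 * L ^ 4 - 3) * ((1200 * (L : ℝ) ^ 4 * β) ^ (9 * L ^ 4 - 1))⁻¹) ≤
      ∫ P, Real.exp (-(β * swapRingDeficit L (fun _ => false) P)) ∂(ringMeasure L) := by
  haveI := isProbabilityMeasure_ringMeasure (L := L)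
  have hβ0 : 0 < β := by linarith
  have hL : (0 : ℝ) < L := by exact_mod_cast NeZero.pos L
  have hK : (0 : ℝ) < 1200 * (L : ℝ) ^ 4 := by positivity
  have hKt : 0 < 1200 * (L : ℝ) ^ 4 * s₀ ^ 2 := by positivity
  set S : Set ((Fin (2 * L - 1 + 1) → GaugeConfig 3 L SU2) × (Site 3 L → SU2)) :=
    {P | swapRingDeficit L (fun _ => false) P ≤ 1 / β} with hS
  have hSm : MeasurableSet S := measurableSet_le (measurable_swapRingDeficit _) measurable_const
  have hu : 1 / β ≤ 1200 * (L : ℝ) ^ 4 * s₀ ^ 2 := by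
    rw [one_div]; exact inv_le_of_inv_le₀ hKt hβ₀
  have hvolu := swap_volume_floor_of_leaderVolume (L := L) hs₀ hs₀1 hvol (u := 1 / β) (by positivity) hu
  have hrew : (1 / β / (1200 * (L : ℝ) ^ 4)) ^ (9 * L ^ 4 - 1) = ((1200 * (L : ℝ) ^ 4 * β) ^ (9 * L ^ 4 - 1))⁻¹ := by
    rw [← inv_pow]; congr 1; field_simp
  rw [hrew] at hvolu
  have hind : ∀ P, S.indicator (fun _ => Real.exp (-1)) P ≤ Real.exp (-(β * swapRingDeficit L (fun _ => false) P)) := by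
    intro P
    by_cases hP : P ∈ S
    · rw [Set.indicator_of_mem hP, Real.exp_le_exp]
      have h : β * swapRingDeficit L (fun _ => false) P ≤ β * (1 / β) := mul_le_mul_of_nonneg_left hP hβ0.le
      rw [mul_one_div_cancel hβ0.ne'] at h
      linarith
    · rw [Set.indicator_of_notMem hP]; exact (Real.exp_pos _).le
  calc Real.exp (-1) * (c * (1 / 34 : ℝ) ^ (6 * L ^ 4 - 3) * ((1200 * (L : ℝ) ^ 4 * β) ^ (9 * L ^ 4 - 1))⁻¹)
      ≤ Real.exp (-1) * (ringMeasure L).real S := mul_le_mul_of_nonneg_left hvolu (Real.exp_pos _).le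
    _ = ∫ P, S.indicator (fun _ => Real.exp (-1)) P ∂(ringMeasure L) := by
        rw [integral_indicator_const _ hSm, smul_eq_mul, mul_comm]
    _ ≤ ∫ P, Real.exp (-(β * swapRingDeficit L (fun _ => false) P)) ∂(ringMeasure L) :=
        integral_mono ((integrable_const _).indicator hSm)
          (by
            refine Integrable.of_bound ((measurable_swapRingDeficit _).const_mul β |>.neg.exp).aestronglyMeasurable 1
              (ae_of_all _ fun P => ?_)
            rw [Real.norm_eq_abs, abs_of_nonneg (Real.exp_pos _).le]
            exact Real.exp_le_one_iff.mpr (by have := swapRingDeficit_nonneg (L := L) (fun _ => false) P; nlinarith))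
          hind

/-- ★★ **LOG-FREE FLOOR OF THE σ-GLUED ZERO-FLUX TRACE AT FIXED `L`** from a leader volume bound: for `β ≥ 1` with `(1200L⁴s₀²)⁻¹ ≤ β`,
`(1/8)·e^{12βL⁴}·e^{−1}c(1/34)^{6L⁴−3}(1200L⁴β)^{−(9L⁴−1)} ≤ TT.twistTrace L β (2L)` — the exponent `9L⁴ − 1` of the σ-glued flat moduli (generic stratum
`C₀ = C₁` of dimension `3`, one less than the periodic `4`; swap-central cone of commuting triples: no logarithm), against the periodic `9L⁴ − 3/2` (+ log).
(✓`exp_mul_integral_deficit_le_twistTrace`.) [cite: tHooft1979] [cite: Luscher1983, §2] [cite: GonzalezarroyoAltes1988] -/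
theorem swap_twistTrace_floor_of_leaderVolume {c s₀ : ℝ} (hs₀ : 0 < s₀) (hs₀1 : s₀ ≤ 1)
    (hvol : ∀ s : ℝ, 0 < s → s ≤ s₀ → c * s ^ 7 ≤
      (Measure.pi fun _ : Fin 4 => haarProbability SU2).real {C : Fin 4 → SU2 |
        (∀ μ ν : Fin 3, frobNorm (((C (Fin.castSucc μ) * C (Fin.castSucc ν) : SU2) : Matrix (Fin 2) (Fin 2) ℂ) -
          ((C (Fin.castSucc ν) * C (Fin.castSucc μ) : SU2) : Matrix (Fin 2) (Fin 2) ℂ)) ≤ s) ∧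
        ∀ μ : Fin 3, frobNorm (((C (Fin.last 3) * C (Fin.castSucc (Equiv.swap (0 : Fin 3) 1 μ)) : SU2) : Matrix (Fin 2) (Fin 2) ℂ) -
          ((C (Fin.castSucc μ) * C (Fin.last 3) : SU2) : Matrix (Fin 2) (Fin 2) ℂ)) ≤ s})
    {β : ℝ} (hβ : 1 ≤ β) (hβ₀ : (1200 * (L : ℝ) ^ 4 * s₀ ^ 2)⁻¹ ≤ β) :
    (1 / 8 : ℝ) * (Real.exp (12 * β * (L : ℝ) ^ 4) *
        (Real.exp (-1) * (c * (1 / 34 : ℝ) ^ (6 * L ^ 4 - 3) * ((1200 * (L : ℝ) ^ 4 * β) ^ (9 * L ^ 4 - 1))⁻¹))) ≤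
      TT.twistTrace L β (2 * L) := by
  have hlap := swap_laplace_floor_of_leaderVolume (L := L) hs₀ hs₀1 hvol hβ hβ₀
  refine le_trans ?_ (exp_mul_integral_deficit_le_twistTrace (L := L) β)
  exact mul_le_mul_of_nonneg_left (mul_le_mul_of_nonneg_left hlap (Real.exp_pos _).le) (by norm_num)

end Summit.QuantumFields.YangMills.Theorems.SwapVirialDeficit.SwapRing

end
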